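import Mathlib
import Summits.Ventures.HodgeRepro.OcticCMPointS3SignsInertTwo
import Summits.Ventures.HodgeRepro.OcticCMPointTruncFourAll
import Summits.Ventures.HodgeRepro.OcticCMPointEightSign
import Summits.Ventures.HodgeRepro.OcticCMPointGaloisRing16Norm
import Summits.Ventures.HodgeRepro.OcticCMPointS3SignsRamifiedEven

/-!
# OcticCMPointS3SignsEven — the root numbers of the octic point at `S₃` at every transcribed even conductor, in one statement

Blind re-derivation cell `pub-hodge-repro`, seat night-2 (gen 5).  Target tree path
`lean/Summits/Ventures/HodgeRepro/OcticCMPointS3SignsEven.lean`.  The capstone of gen 5: for the CM point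
`E = ℚ(ζ₅, √(4 + √5))` of S8's first open cell and its places `S₃ = {𝔭₁, 𝔭₂ | 5, 𝔮 | 2}`, the local root numbers of
EVERY conjugate-dual character at the even conductors transcribed so far — and at conductor `1` — are in closed form:

* **`S3_signs_inert`** — at the inert place `𝔮 | 2` the unit part of a conjugate-dual character contributes NOTHING:
  `ε(½, ω, ψ̃) = ω(ϖ)^n` at conductor `1` (`OcticCMPointInertGauss`, `𝔤 = +4`), conductor `2`
  (`OcticCMPointGaloisRingE3`, `tr(δt) = 0` on the `σ`-fixed lifts of `𝔽₄`, `θ⁵ = 1`) and conductor `4`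
  (`OcticCMPointGaloisRing16Norm`, every `σ`-fixed unit is a norm — Hensel on the model).
* **`S3_signs_ramified_even`** (in `OcticCMPointS3SignsRamifiedEven`, imported) — at the ramified places `𝔭 | 5` the root number at the even conductors `2`, `4`, `8`, `6` is
  `ω(ϖ)^n` times a sign read on the `σ`-fixed residue of the stationary point: `θ(β)` at `c = 2`
  (`OcticCMPointDualSign`), `ρ(c₀)^{−1}` with `c₀ ∈ 𝔽₅^×` at `c = 4` (`OcticCMPointTruncFourAll`), `ρ(a₀)^{−1}` with
  `a₀` the even part of the stationary point at `c = 8` (`OcticCMPointEightSign`) — each sign `±1`, and `+1` for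
  characters trivial on the `σ`-fixed units (the conjugate-orthogonal shape).
* **`S3_classes_inert`** — the two classes of the route at `𝔮` on the nose: `ε = (−1)^n` for `ω(ϖ) = −1`, `ε = 1` for
  `ω(ϖ) = 1`, at conductors `1`, `2`, `4`.
* **`S3_E3_even`** — (E3) at every one of these rows, for four lines trivial on the `σ`-fixed units (at `𝔮`: for ALL
  four lines), is the `ϖ`-part `π₀π₁ = π₂π₃` of N2; `E3At_of_GR16` feeds the conductor-`4` inert row into the chain's
  `E3At` by name (as `OcticCMPointS3SignsInertTwo.E3At_of_GR44` at conductor `2` and `OcticCMPointEightSign.E3At_of_eight`).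

All of it is Kudla Prop. 3.8 (ii) / (3.32) (`book:editornd-introduction-langlands-program` p0109:L3–L11, L33) on gen 1's
model, evaluated by the even-conductor stationary phase of `GaussSumEvenConductor.lean`.

**What this is not.**  The odd conductors beyond `c = 3` at `𝔭` and `c = 3` at `𝔮`, `c ∈ {5, 6, 7}` and `c > 8` at `𝔭`,
`c > 4` at `𝔮`, the four `χ′_j` of the face (no page) and `Identification` are NOT here.  Nothing here says anything
about the status of the Hodge conjecture for CM abelian varieties, which is NOT proved.
-/

set_option autoImplicit false

noncomputable section

namespace Summit.Ventures.HodgeRepro.PeriodCloser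

open GaussSumStability

/-- **The inert place `𝔮 | 2`, conductors `1`, `2`, `4`: `ε(½, ω, ψ̃) = ω(ϖ)^n` for every conjugate-dual character.** -/
theorem S3_signs_inert (n : ℕ) :
    (∀ ω : LocalChar InertModel.F16, ω.unit ≠ 1 → (∀ x, ω.unit (InertModel.conj x) = ω.unit⁻¹ x) →
        LocalChar.eps (1 / 4) n ω (InertModel.psiTilde InertModel.psi0) = ω.piVal ^ n) ∧
    (∀ ω : LocalChar GaloisRing.GR44, (∃ a, ω.unit (1 + 2 * a) ≠ 1) →
        (∀ x, ω.unit (GaloisRing.conjGR x) = ω.unit⁻¹ x) →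
        LocalChar.eps (1 / 16) n ω GaloisRing.psiTildeGR = ω.piVal ^ n) ∧
    (∀ ρ : LocalChar GaloisRing16.GR164, (∀ x, ρ.unit (GaloisRing16.conjGR x) = ρ.unit⁻¹ x) →
        ∀ a : GaloisRing16.GR164ˣ, LocalChar.Primitive GaloisRing16.psiTildeGR16 GaloisRing16.I4 ρ a →
        LocalChar.eps (1 / 256) n ρ GaloisRing16.psiTildeGR16 = ρ.piVal ^ n) :=
  ⟨fun ω hω hσ => InertModel.eps_eq_piVal_pow_psi0 n ω hω hσ,
    fun ω hc hσ => GaloisRing.eps_eq_piVal_pow_two ω hc hσ n,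
    fun ρ hσ a hρ => GaloisRing16.eps_four_inert_exact n ρ hσ a hρ⟩

/-- **The two classes of the route at the inert place, on the nose**: a conjugate-symplectic character has `ω(ϖ) = −1`
(`ω_{K_v/k_v}` is unramified at `𝔮`, `ϖ = 2 ∈ k_v`) and a conjugate-orthogonal one `ω(ϖ) = 1`, so at conductors `1`, `2`, `4`
`ε(½, ω, ψ̃) = (−1)^n` resp. `1`. -/
theorem S3_classes_inert (n : ℕ) :
    (∀ ω : LocalChar InertModel.F16, ω.unit ≠ 1 → (∀ x, ω.unit (InertModel.conj x) = ω.unit⁻¹ x) →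
        (ω.piVal = -1 → LocalChar.eps (1 / 4) n ω (InertModel.psiTilde InertModel.psi0) = (-1) ^ n) ∧
        (ω.piVal = 1 → LocalChar.eps (1 / 4) n ω (InertModel.psiTilde InertModel.psi0) = 1)) ∧
    (∀ ω : LocalChar GaloisRing.GR44, (∃ a, ω.unit (1 + 2 * a) ≠ 1) →
        (∀ x, ω.unit (GaloisRing.conjGR x) = ω.unit⁻¹ x) →
        (ω.piVal = -1 → LocalChar.eps (1 / 16) n ω GaloisRing.psiTildeGR = (-1) ^ n) ∧
        (ω.piVal = 1 → LocalChar.eps (1 / 16) n ω GaloisRing.psiTildeGR = 1)) ∧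
    (∀ ρ : LocalChar GaloisRing16.GR164, (∀ x, ρ.unit (GaloisRing16.conjGR x) = ρ.unit⁻¹ x) →
        ∀ a : GaloisRing16.GR164ˣ, LocalChar.Primitive GaloisRing16.psiTildeGR16 GaloisRing16.I4 ρ a →
        (ρ.piVal = -1 → LocalChar.eps (1 / 256) n ρ GaloisRing16.psiTildeGR16 = (-1) ^ n) ∧
        (ρ.piVal = 1 → LocalChar.eps (1 / 256) n ρ GaloisRing16.psiTildeGR16 = 1)) := by
  obtain ⟨h1, h2, h3⟩ := S3_signs_inert n
  refine ⟨fun ω hω hσ => ⟨fun hπ => ?_, fun hπ => ?_⟩, fun ω hc hσ => ⟨fun hπ => ?_, fun hπ => ?_⟩,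
    fun ρ hσ a hρ => ⟨fun hπ => ?_, fun hπ => ?_⟩⟩
  · rw [h1 ω hω hσ, hπ]
  · rw [h1 ω hω hσ, hπ, one_pow]
  · rw [h2 ω hc hσ, hπ]
  · rw [h2 ω hc hσ, hπ, one_pow]
  · rw [h3 ρ hσ a hρ, hπ]
  · rw [h3 ρ hσ a hρ, hπ, one_pow]

/-- **(E3) at `S₃` at the even conductors from the `ϖ`-part of N2**: at `𝔮` (`c = 2`, `c = 4`) for ALL conjugate-dual
lines; at `𝔭` (`c = 4`, `c = 8`, `c = 6`) for lines trivial on the `σ`-fixed units. -/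
theorem S3_E3_even (n : ℕ) :
    (∀ (ω : Fin 4 → LocalChar GaloisRing.GR44), (∀ j, ∃ a, (ω j).unit (1 + 2 * a) ≠ 1) →
        (∀ j x, (ω j).unit (GaloisRing.conjGR x) = (ω j).unit⁻¹ x) →
        (ω 0).piVal * (ω 1).piVal = (ω 2).piVal * (ω 3).piVal →
        LocalChar.eps (1 / 16) n (ω 0) GaloisRing.psiTildeGR * LocalChar.eps (1 / 16) n (ω 1) GaloisRing.psiTildeGR =
          LocalChar.eps (1 / 16) n (ω 2) GaloisRing.psiTildeGR * LocalChar.eps (1 / 16) n (ω 3) GaloisRing.psiTildeGR) ∧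
    (∀ (ρ : Fin 4 → LocalChar GaloisRing16.GR164), (∀ j x, (ρ j).unit (GaloisRing16.conjGR x) = (ρ j).unit⁻¹ x) →
        ∀ a : Fin 4 → GaloisRing16.GR164ˣ, (∀ j, LocalChar.Primitive GaloisRing16.psiTildeGR16 GaloisRing16.I4 (ρ j) (a j)) →
        (ρ 0).piVal * (ρ 1).piVal = (ρ 2).piVal * (ρ 3).piVal →
        LocalChar.eps (1 / 256) n (ρ 0) GaloisRing16.psiTildeGR16 * LocalChar.eps (1 / 256) n (ρ 1) GaloisRing16.psiTildeGR16 =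
          LocalChar.eps (1 / 256) n (ρ 2) GaloisRing16.psiTildeGR16 *
            LocalChar.eps (1 / 256) n (ρ 3) GaloisRing16.psiTildeGR16) ∧
    (∀ (ψ₀ : AddChar (ZMod 5) ℂ), ψ₀.IsPrimitive → ∀ (ρ : Fin 4 → LocalChar (TruncModel.Trunc (ZMod 5) 4)),
        (∀ j x, (ρ j).unit (TruncModel.conjHom 4 x) = (ρ j).unit⁻¹ x) →
        (∀ j (r : ZMod 5), r ≠ 0 → (ρ j).unit (algebraMap (ZMod 5) _ r) = 1) →
        ∀ a : Fin 4 → (TruncModel.Trunc (ZMod 5) 4)ˣ,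
        (∀ j, LocalChar.Primitive (TruncModel.psiTilde 4 ψ₀) TruncModel.I2 (ρ j) (a j)) →
        (ρ 0).piVal * (ρ 1).piVal = (ρ 2).piVal * (ρ 3).piVal →
        LocalChar.eps ((1 / 25 : ℝ) : ℂ) n (ρ 0) (TruncModel.psiTilde 4 ψ₀) *
            LocalChar.eps ((1 / 25 : ℝ) : ℂ) n (ρ 1) (TruncModel.psiTilde 4 ψ₀) =
          LocalChar.eps ((1 / 25 : ℝ) : ℂ) n (ρ 2) (TruncModel.psiTilde 4 ψ₀) *
            LocalChar.eps ((1 / 25 : ℝ) : ℂ) n (ρ 3) (TruncModel.psiTilde 4 ψ₀)) ∧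
    (∀ (ρ : Fin 4 → LocalChar EightModel.R8), (∀ j x, (ρ j).unit (EightModel.conj x) = (ρ j).unit⁻¹ x) →
        (∀ j (u : EightModel.R8ˣ), EightModel.conj (u : EightModel.R8) = u → (ρ j).unit (u : EightModel.R8) = 1) →
        ∀ a : Fin 4 → EightModel.R8ˣ, (∀ j, LocalChar.Primitive EightModel.psiTilde EightModel.I5 (ρ j) (a j)) →
        (ρ 0).piVal * (ρ 1).piVal = (ρ 2).piVal * (ρ 3).piVal →
        LocalChar.eps (1 / 625) n (ρ 0) EightModel.psiTilde * LocalChar.eps (1 / 625) n (ρ 1) EightModel.psiTilde =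
          LocalChar.eps (1 / 625) n (ρ 2) EightModel.psiTilde * LocalChar.eps (1 / 625) n (ρ 3) EightModel.psiTilde) ∧
    (∀ (ρ : Fin 4 → LocalChar SixModel.R6), (∀ j x, (ρ j).unit (SixModel.conj6 x) = (ρ j).unit⁻¹ x) →
        (∀ j (u : SixModel.R6ˣ), SixModel.conj6 (u : SixModel.R6) = u → (ρ j).unit (u : SixModel.R6) = 1) →
        ∀ a : Fin 4 → SixModel.R6ˣ, (∀ j, LocalChar.Primitive SixModel.psi6 SixModel.I6 (ρ j) (a j)) →
        (ρ 0).piVal * (ρ 1).piVal = (ρ 2).piVal * (ρ 3).piVal →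
        LocalChar.eps (1 / 125) n (ρ 0) SixModel.psi6 * LocalChar.eps (1 / 125) n (ρ 1) SixModel.psi6 =
          LocalChar.eps (1 / 125) n (ρ 2) SixModel.psi6 * LocalChar.eps (1 / 125) n (ρ 3) SixModel.psi6) :=
  ⟨fun ω hc hσ hN2 => GaloisRing.E3_inert_two_exact ω hc hσ hN2 n,
    fun ρ hσ a hρ hN2 => GaloisRing16.E3_four_inert_exact n ρ hσ a hρ hN2,
    fun ψ₀ h₀ ρ hσ hfix a hρ hN2 =>
      TruncModel.E3_four_all (by decide) ψ₀ h₀ n ρ hσ hfix a hρ _ (by rw [ZMod.card]; norm_num) hN2,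
    fun ρ hσ hfix a hρ hN2 => EightModel.E3_eight n ρ hσ hfix a hρ hN2,
    fun ρ hσ hfix a hρ hN2 => SixModel.E3_six n ρ hσ hfix a hρ _ SixModel.kappa_mul_card_six hN2⟩


open NumberField in
/-- **(E3) at a place of `S₃` of a face from the conductor-`4` inert model, by the chain's name**: if the face's four
local signs at `v` are the model's `ε(½, ρ_j, ψ̃_δ)` for conjugate-dual `ρ_j` of conductor exactly `4` on `GR(16, 4)` with
`π₀π₁ = π₂π₃`, then `E3At I v d` (`PeriodCloserC7Stability.E3At_of_complex`, `GaloisRing16.E3_four_inert_exact`). -/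
theorem E3At_of_GR16 {L : Type} [Field L] [NumberField L] [IsCMField L] (I : C7Face L) (v : I.Place)
    (d : I.Datum) (n : ℕ) (ρ : Fin 4 → LocalChar GaloisRing16.GR164)
    (hσ : ∀ j x, (ρ j).unit (GaloisRing16.conjGR x) = (ρ j).unit⁻¹ x) (a : Fin 4 → GaloisRing16.GR164ˣ)
    (hρ : ∀ j, LocalChar.Primitive GaloisRing16.psiTildeGR16 GaloisRing16.I4 (ρ j) (a j))
    (hN2 : (ρ 0).piVal * (ρ 1).piVal = (ρ 2).piVal * (ρ 3).piVal)
    (he : ∀ j, ((I.localRootNumber v (I.chars d j) : ℤ) : ℂ) =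
      LocalChar.eps (1 / 256) n (ρ j) GaloisRing16.psiTildeGR16) :
    E3At I v d :=
  E3At_of_complex I v d (fun j => LocalChar.eps (1 / 256) n (ρ j) GaloisRing16.psiTildeGR16) he
    (GaloisRing16.E3_four_inert_exact n ρ hσ a hρ hN2)


open NumberField in
/-- **(E3) at a place of `S₃` of a face from the conductor-`4` ramified model, by the chain's name**: if the face's four
local signs at `v` are the model's `ε(½, ρ_j, ψ̃)` (`κ = 1/25`) for conjugate-dual `ρ_j` of conductor exactly `4` on
`𝒪/𝔭⁴` trivial on the `σ`-fixed units, with `π₀π₁ = π₂π₃`, then `E3At I v d` (`TruncModel.E3_four_all`). -/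
theorem E3At_of_four {L : Type} [Field L] [NumberField L] [IsCMField L] (I : C7Face L) (v : I.Place)
    (d : I.Datum) (n : ℕ) (ψ₀ : AddChar (ZMod 5) ℂ) (h₀ : ψ₀.IsPrimitive)
    (ρ : Fin 4 → LocalChar (TruncModel.Trunc (ZMod 5) 4))
    (hσ : ∀ j x, (ρ j).unit (TruncModel.conjHom 4 x) = (ρ j).unit⁻¹ x)
    (hfix : ∀ j (r : ZMod 5), r ≠ 0 → (ρ j).unit (algebraMap (ZMod 5) _ r) = 1)
    (a : Fin 4 → (TruncModel.Trunc (ZMod 5) 4)ˣ)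
    (hρ : ∀ j, LocalChar.Primitive (TruncModel.psiTilde 4 ψ₀) TruncModel.I2 (ρ j) (a j))
    (hN2 : (ρ 0).piVal * (ρ 1).piVal = (ρ 2).piVal * (ρ 3).piVal)
    (he : ∀ j, ((I.localRootNumber v (I.chars d j) : ℤ) : ℂ) =
      LocalChar.eps ((1 / 25 : ℝ) : ℂ) n (ρ j) (TruncModel.psiTilde 4 ψ₀)) :
    E3At I v d :=
  E3At_of_complex I v d (fun j => LocalChar.eps ((1 / 25 : ℝ) : ℂ) n (ρ j) (TruncModel.psiTilde 4 ψ₀)) he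
    (TruncModel.E3_four_all (by decide) ψ₀ h₀ n ρ hσ hfix a hρ _ (by rw [ZMod.card]; norm_num) hN2)

end Summit.Ventures.HodgeRepro.PeriodCloser

end
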